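import Mathlib
import HarnessLib
import Summits.Ventures.LatticeQCDFlow.Exactness.KernelSymmetry
import Summits.Ventures.LatticeQCDFlow.Exactness.SplittingIntegrator

/-!
# Gauge-link FT-HMC kernels inherit the symmetries of their data: the leapfrog proposal commutes with `θ × R`, and what `conjKernel K Θ = K` means for the run

HONEST FRAMING: exact (Metropolis-corrected) sampling algorithms for lattice gauge theory;
figures of merit are autocorrelation/cost numbers at stated couplings and volumes; no
continuum-physics claim.

Venture `LatticeQCDFlow` (cell pub-lqcd), topic `Exactness`; FANOUT row 14 (`eng-flowhmc`, engine
`latflow.fthmc`: refresh momenta, leapfrog with the link drift `U ← e(p) · U` and a force routine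
`g`, flip, Metropolis on `H̃ = (S∘F − log J) + T`, forget, report `F V`).  NEW WORK of the cell;
nothing is cited as a fact; no number.  `KernelSymmetry.thmc_conjKernel_eq_self` (GEN-9) reduces
"the FT-HMC configuration kernel commutes with a symmetry `Θ` of the links" to four commutation
facts involving a momentum symmetry `R`.  This file supplies the group-agnostic half of the
instantiation for row 14's CONCRETE proposal (row 9's `flip`, `kick`, `drift`, `mulDrift`,
`leapfrog` of `SplittingIntegrator.lean`) and spells out what the conclusion means:

* §1 (phase-space algebra, links in any group `Q`, momenta in any additive group `P`): the gauge
  leapfrog proposal `flip ∘ (drift_e ∘ kick_g ∘ drift_e)^n` commutes with `θ × R` as soon as `R`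
  is additive and odd, the drift is covariant (`e (R p) · θ q = θ (e p · q)`) and the force is
  covariant (`g (θ q) = R (g q)`) — `commute_flip_leapfrog_pow_prodMap` (any `n`);
* §2 (what `conjKernel K Θ = K` means, any measurable space): `K (Θ y) A = K y (Θ⁻¹ A)`
  (`apply_eq_of_conjKernel_eq_self`); `(Θ_* μ) K = Θ_* (μ K)` and, iterating, the law of the run
  started from `Θ_* μ₀` is at every time `Θ_*` of the law of the run started from `μ₀`
  (`iterate_bind_map_of_conjKernel_eq_self`), so the two runs agree on `Θ`-invariant events
  (`iterate_bind_map_apply_of_preimage_eq`); all iterates `nHit K t` are symmetric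
  (`conjKernel_nHit_eq_self`); `map_withDensity_eq_of_measurePreserving` (an `R`-invariant
  density against an `R`-invariant reference gives an `R`-invariant law — the momentum law);
* §3 **`gauge_fthmc_conjKernel_eq_self`** — links in a measurable group `Q`, momenta `P` with
  reference `ν` and kinetic term `T`, member `F : Q ≃ᵐ Q` with booked density `J`, action `S`:
  if `R` is additive, odd and `ν`-preserving, `T ∘ R = T`, the drift and the force are covariant,
  `F ∘ Θ = Θ ∘ F`, `S ∘ Θ = S`, `J ∘ Θ = J`, then the reported FT-HMC configuration kernel
  `K = F ∘ (refresh π ∼ Z⁻¹e^{−T}ν; involMH (flip ∘ leapfrog^n) H̃; forget) ∘ F⁻¹` satisfies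
  `conjKernel K Θ = K`.

The `SU(2)` rung (gauge transformations `V ↦ V^h`, `R_h = Ad_h` on `(Edge × Fin 3) → ℝ` from
`SU2MomentumRotation`) is the sequel `SU2FTHMCGaugeCovariance.lean`.

NOT CLAIMED: anything about a concrete group, force routine or member; any number.
-/

noncomputable section

namespace Summit.Ventures.LatticeQCDFlow.Exactness

open Set MeasureTheory ProbabilityTheory ProbabilityTheory.Kernel
open scoped ENNReal

/-! ## §1 Phase-space algebra: the gauge leapfrog proposal commutes with `θ × R` -/

section PhaseSpace

variable {Q P : Type*}

/-- The momentum flip commutes with `θ × R` for every odd `R`. -/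
theorem commute_flip_prodMap [AddCommGroup P] (θ : Q → Q) {R : P → P} (hRneg : ∀ p, R (-p) = -R p) :
    Function.Commute (⇑(flip : Equiv.Perm (Q × P))) (fun z : Q × P => (θ z.1, R z.2)) :=
  fun z => by
    change ((θ z.1, -R z.2) : Q × P) = (θ z.1, R (-z.2))
    rw [hRneg]

/-- A kick by a COVARIANT force (`g (θ q) = R (g q)`) commutes with `θ × R` (`R` additive). -/
theorem commute_kick_prodMap [AddCommGroup P] {g : Q → P} {θ : Q → Q} {R : P → P}
    (hRadd : ∀ p p', R (p + p') = R p + R p') (hg : ∀ q, g (θ q) = R (g q)) :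
    Function.Commute (⇑(kick g)) (fun z : Q × P => (θ z.1, R z.2)) :=
  fun z => by
    change ((θ z.1, R z.2 + g (θ z.1)) : Q × P) = (θ z.1, R (z.2 + g z.1))
    rw [hg, hRadd]

/-- The group drift `q ↦ e p · q` commutes with `θ × R` when `e (R p) · θ q = θ (e p · q)`. -/
theorem commute_drift_mulDrift_prodMap [Group Q] {e : P → Q} {θ : Q → Q} {R : P → P}
    (he : ∀ p q, e (R p) * θ q = θ (e p * q)) :
    Function.Commute (⇑(drift (mulDrift e))) (fun z : Q × P => (θ z.1, R z.2)) :=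
  fun z => by
    change ((e (R z.2) * θ z.1, R z.2) : Q × P) = (θ (e z.2 * z.1), R z.2)
    rw [he]

/-- Hence one leapfrog step `drift ∘ kick ∘ drift` commutes with `θ × R`. -/
theorem commute_leapfrog_mulDrift_prodMap [Group Q] [AddCommGroup P] {e : P → Q} {g : Q → P}
    {θ : Q → Q} {R : P → P}
    (hRadd : ∀ p p', R (p + p') = R p + R p') (he : ∀ p q, e (R p) * θ q = θ (e p * q))
    (hg : ∀ q, g (θ q) = R (g q)) :
    Function.Commute (⇑(leapfrog (mulDrift e) g)) (fun z : Q × P => (θ z.1, R z.2)) := by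
  rw [leapfrog, Equiv.Perm.coe_mul, Equiv.Perm.coe_mul]
  exact ((commute_drift_mulDrift_prodMap he).comp_left (commute_kick_prodMap hRadd hg)).comp_left
    (commute_drift_mulDrift_prodMap he)

/-- **The gauge leapfrog proposal `flip ∘ leapfrog^n` commutes with `θ × R`** — `R` additive and
odd, drift covariant, force covariant; any trajectory length `n`. -/
theorem commute_flip_leapfrog_pow_prodMap [Group Q] [AddCommGroup P] {e : P → Q} {g : Q → P}
    {θ : Q → Q} {R : P → P}
    (hRneg : ∀ p, R (-p) = -R p) (hRadd : ∀ p p', R (p + p') = R p + R p')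
    (he : ∀ p q, e (R p) * θ q = θ (e p * q)) (hg : ∀ q, g (θ q) = R (g q)) (n : ℕ) :
    Function.Commute (⇑((flip : Equiv.Perm (Q × P)) * leapfrog (mulDrift e) g ^ n))
      (fun z : Q × P => (θ z.1, R z.2)) := by
  rw [Equiv.Perm.coe_mul, Equiv.Perm.coe_pow]
  exact (commute_flip_prodMap θ hRneg).comp_left
    ((commute_leapfrog_mulDrift_prodMap hRadd he hg).iterate_left n)

end PhaseSpace

/-! ## §2 What `conjKernel K Θ = K` means -/

section Meaning

variable {Ω : Type*} [MeasurableSpace Ω]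

/-- `conjKernel κ Θ = κ` pointwise: the transition probability from `Θ y` into `s` is the
transition probability from `y` into `Θ⁻¹ s`. -/
theorem apply_eq_of_conjKernel_eq_self {κ : Kernel Ω Ω} {Θ : Ω ≃ᵐ Ω} (hκ : conjKernel κ Θ = κ)
    (y : Ω) {s : Set Ω} (hs : MeasurableSet s) : κ (Θ y) s = κ y (Θ ⁻¹' s) := by
  conv_lhs => rw [← hκ]
  rw [conjKernel_apply' _ _ _ hs, MeasurableEquiv.symm_apply_apply]

/-- A symmetric kernel transports laws covariantly: `(Θ_* μ) K = Θ_* (μ K)`. -/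
theorem map_bind_of_conjKernel_eq_self {κ : Kernel Ω Ω} {Θ : Ω ≃ᵐ Ω} (hκ : conjKernel κ Θ = κ)
    (μ : Measure Ω) : (μ.map Θ).bind κ = (μ.bind κ).map Θ := by
  ext s hs
  rw [Measure.bind_apply hs (Kernel.aemeasurable _), lintegral_map_equiv,
    Measure.map_apply Θ.measurable hs, Measure.bind_apply (Θ.measurable hs) (Kernel.aemeasurable _)]
  simp only [apply_eq_of_conjKernel_eq_self hκ _ hs]

/-- **Hence the whole run is covariant**: the law after `t` steps from the initial law `Θ_* μ₀`
is `Θ_*` of the law after `t` steps from `μ₀`. -/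
theorem iterate_bind_map_of_conjKernel_eq_self {κ : Kernel Ω Ω} {Θ : Ω ≃ᵐ Ω}
    (hκ : conjKernel κ Θ = κ) (μ₀ : Measure Ω) (t : ℕ) :
    (fun m : Measure Ω => m.bind κ)^[t] (μ₀.map Θ) = ((fun m : Measure Ω => m.bind κ)^[t] μ₀).map Θ := by
  induction t with
  | zero => rfl
  | succ t ih =>
    simp only [Function.iterate_succ_apply', ih, map_bind_of_conjKernel_eq_self hκ]

/-- On `Θ`-invariant events the two runs agree at every time. -/
theorem iterate_bind_map_apply_of_preimage_eq {κ : Kernel Ω Ω} {Θ : Ω ≃ᵐ Ω}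
    (hκ : conjKernel κ Θ = κ) (μ₀ : Measure Ω) (t : ℕ) {A : Set Ω} (hA : MeasurableSet A)
    (hΘA : Θ ⁻¹' A = A) :
    (fun m : Measure Ω => m.bind κ)^[t] (μ₀.map Θ) A = (fun m : Measure Ω => m.bind κ)^[t] μ₀ A := by
  rw [iterate_bind_map_of_conjKernel_eq_self hκ, Measure.map_apply Θ.measurable hA, hΘA]

/-- All iterates of a symmetric kernel are symmetric: `conjKernel (nHit κ t) Θ = nHit κ t`. -/
theorem conjKernel_nHit_eq_self {κ : Kernel Ω Ω} {Θ : Ω ≃ᵐ Ω} (hκ : conjKernel κ Θ = κ) (t : ℕ) :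
    conjKernel (nHit κ t) Θ = nHit κ t := by
  rw [conjKernel_nHit, hκ]

/-- An `R`-invariant density against an `R`-invariant measure: `R_* (f · ν) = f · ν`. -/
theorem map_withDensity_eq_of_measurePreserving {ν : Measure Ω} (R : Ω ≃ᵐ Ω)
    (hR : MeasurePreserving R ν ν) {f : Ω → ℝ≥0∞} (hf : Measurable f) (hfR : ∀ p, f (R p) = f p) :
    (ν.withDensity f).map R = ν.withDensity f := by
  ext s hs
  rw [Measure.map_apply R.measurable hs, withDensity_apply _ (R.measurable hs), withDensity_apply _ hs,
    ← hR.setLIntegral_comp_preimage hs hf]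
  exact setLIntegral_congr_fun (R.measurable hs) (fun p _ => (hfR p).symm)

end Meaning

/-! ## §3 The gauge-link FT-HMC kernel inherits the symmetries of its data -/

section Kernel

variable {Q P : Type*} [Group Q] [MeasurableSpace Q] [MeasurableMul₂ Q]
  [AddCommGroup P] [MeasurableSpace P] [MeasurableNeg P] [MeasurableAdd₂ P]

/-- **The gauge-link FT-HMC configuration kernel inherits every symmetry of its data.**  Links in a
measurable group `Q`, momenta in `P` with reference measure `ν`, kinetic term `T`, drift
`q ↦ e p · q`, force `g`, member `F : Q ≃ᵐ Q` with booked density `J`, action `S`; symmetry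
`Θ : Q ≃ᵐ Q` of the links and `R : P ≃ᵐ P` of the momenta with: `R` additive and odd,
`e (R p) · Θ q = Θ (e p · q)`, `g ∘ Θ = R ∘ g`, `F ∘ Θ = Θ ∘ F`, `S ∘ Θ = S`, `J ∘ Θ = J`, `T ∘ R = T`,
`R_* ν = ν`.  Then the kernel `K = F ∘ (refresh π ∼ Z⁻¹e^{−T}ν; involMH (flip ∘ leapfrog^n) H̃; forget) ∘ F⁻¹`,
`H̃ = (S∘F − log J) + T`, satisfies `conjKernel K Θ = K`. -/
theorem gauge_fthmc_conjKernel_eq_self {ν : Measure P} [SFinite ν] {e : P → Q} (hem : Measurable e)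
    {g : Q → P} (hg : Measurable g) (n : ℕ) {S : Q → ℝ} (hS : Measurable S) {T : P → ℝ}
    (hT : Measurable T) (F : Q ≃ᵐ Q) {J : Q → ℝ} (hJm : Measurable J) (Θ : Q ≃ᵐ Q) (R : P ≃ᵐ P)
    (hRneg : ∀ p, R (-p) = -R p) (hRadd : ∀ p p', R (p + p') = R p + R p')
    (he : ∀ p q, e (R p) * Θ q = Θ (e p * q)) (hgΘ : ∀ q, g (Θ q) = R (g q))
    (hFΘ : ∀ q, F (Θ q) = Θ (F q)) (hSΘ : ∀ q, S (Θ q) = S q) (hJΘ : ∀ q, J (Θ q) = J q)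
    (hTR : ∀ p, T (R p) = T p) (hRν : MeasurePreserving R ν ν) :
    conjKernel
      (conjKernel
        (refreshUpdate
          (involMH (⇑((flip : Equiv.Perm (Q × P)) * leapfrog (mulDrift e) g ^ n))
            (measurable_flip_leapfrog_pow (measurable_mulDrift hem) hg n)
            fun z : Q × P => (S (F z.1) - Real.log (J z.1)) + T z.2)
          ((ν.withDensity (fun q => ENNReal.ofReal (Real.exp (-T q))) Set.univ)⁻¹ •
            ν.withDensity fun q => ENNReal.ofReal (Real.exp (-T q))))
        F) Θ =
      conjKernel
        (refreshUpdate
          (involMH (⇑((flip : Equiv.Perm (Q × P)) * leapfrog (mulDrift e) g ^ n))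
            (measurable_flip_leapfrog_pow (measurable_mulDrift hem) hg n)
            fun z : Q × P => (S (F z.1) - Real.log (J z.1)) + T z.2)
          ((ν.withDensity (fun q => ENNReal.ofReal (Real.exp (-T q))) Set.univ)⁻¹ •
            ν.withDensity fun q => ENNReal.ofReal (Real.exp (-T q))))
        F := by
  have hH : Measurable fun z : Q × P => (S (F z.1) - Real.log (J z.1)) + T z.2 :=
    (((hS.comp F.measurable).sub (Real.measurable_log.comp hJm)).comp measurable_fst).add
      (hT.comp measurable_snd)
  have hf : Measurable fun q : P => ENNReal.ofReal (Real.exp (-T q)) :=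
    ENNReal.measurable_ofReal.comp (Real.measurable_exp.comp hT.neg)
  have hR : (((ν.withDensity (fun q => ENNReal.ofReal (Real.exp (-T q))) Set.univ)⁻¹ •
      ν.withDensity fun q => ENNReal.ofReal (Real.exp (-T q))).map R) =
      (ν.withDensity (fun q => ENNReal.ofReal (Real.exp (-T q))) Set.univ)⁻¹ •
        ν.withDensity fun q => ENNReal.ofReal (Real.exp (-T q)) := by
    rw [Measure.map_smul, map_withDensity_eq_of_measurePreserving R hRν hf (fun p => by rw [hTR])]
  have hcomm := commute_flip_leapfrog_pow_prodMap (θ := ⇑Θ) (e := e) (g := g) hRneg hRadd he hgΘ n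
  refine thmc_conjKernel_eq_self hH _ F Θ R (fun z => hcomm z) (fun z => ?_) hR ?_
  · change (S (F (Θ z.1)) - Real.log (J (Θ z.1))) + T (R z.2) = (S (F z.1) - Real.log (J z.1)) + T z.2
    rw [hFΘ, hSΘ, hJΘ, hTR]
  · exact MeasurableEquiv.ext (funext fun q => hFΘ q)

end Kernel

end Summit.Ventures.LatticeQCDFlow.Exactness
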